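import Summits.QuantumFields.YangMills.Theorems.LangevinControlUVOSLegsFromFemtoAndGapStubLower
import HarnessLib

/-!
# Crux `UVSeamRec` (stmt-QuantumFields-20043), stub `stub_floors`: compact-witness floors from the femto package

Helper file (`--supports stmt-QuantumFields-20043`) of the lead prover of `stub_floors` (unit `ym-spine-20043-p1`); the
F-B plumbing of the split card «floors by unit transfer» (item evidence `LINE-CARD-stub_floors.md`).

The unit-transfer theorem `UnitTransfer.lowerBounds_of_tendsto_div` (series `BalabanLadderUVSeamRecUnitTransfer*`)
consumes floors with COMPACTLY SUPPORTED witnesses.  The landed collar stub `stub_lower`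
(`Theorems/LangevinControlUVOSLegsFromFemtoAndGapStubLower*.lean`: `FBL → FC2 → FC3 → LowerBounds`) builds its witnesses
as bumps (`exists_bump_schwartz`, `tsupport = closedBall`), but its statement forgets compactness.  This file re-runs
the two assembly proofs `lowerBounds_twoPoint` / `lowerBounds_threePoint` VERBATIM with the one extra conjunct recorded
(`lowerBoundsC_twoPoint`, `lowerBoundsC_threePoint`; every estimate is the landed toolkit's).  The compositions with
`stub_fcp6`, `fbl_of_fbl6` and the unit transfer are in `BalabanLadderUVSeamRecFloorsCEngine`.
-/

set_option autoImplicit false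

noncomputable section

open scoped SchwartzMap
open MeasureTheory Filter Topology Metric
open Literature.MathematicalPhysics.QuantumFieldTheory Literature.MathematicalPhysics.QuantumLattice
open Literature.MathematicalPhysics.AQFT Literature.Probability.LatticeModels
open Summit.QuantumFields.YangMills.Theorems.OSLegsFromFemtoAndGap.StubLower
open Summit.QuantumFields.YangMills.Cruxes.OSLegsFromFemtoAndGap.DlrCollarTransfer
open Summit.QuantumFields.YangMills.Cruxes.OSLegsFromFemtoAndGap.DlrCollarTransfer.StubLower

namespace Summit.QuantumFields.YangMills.Cruxes.UVSeamRec.FloorsC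

section Floors

variable (G : Type) [Group G] [TopologicalSpace G] [IsTopologicalGroup G] [CompactSpace G]
  [MeasurableSpace G] [BorelSpace G] (r : LatticeRep G) (a : ℝ → ℝ)

/-- **The two-point floor with a compactly supported witness** (= landed `StubLower.lowerBounds_twoPoint`, same proof,
recording that the bump `v` has `tsupport v = closedBall`). [folklore] -/
theorem lowerBoundsC_twoPoint (hapos : ∀ β, 0 < a β) (hlim : Tendsto a atTop (𝓝 0))
    (hFBL : FBL G r a) (hFC2 : FC2 G r a) :
    ∃ (v : 𝓢(EuclideanSpace ℝ (Fin 4), ℝ)) (ε β₅ Λ₅ : ℝ),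
      HasCompactSupport (v : EuclideanSpace ℝ (Fin 4) → ℝ) ∧
      tsupport v ⊆ {y : EuclideanSpace ℝ (Fin 4) | 0 < y 0} ∧ 0 < ε ∧
      ∀ β : ℝ, β₅ ≤ β → ∀ L : ℕ, Λ₅ ≤ a β * L → ε ≤ Q2 G r β L (a β) (thetaTest 4 v) v := by
  obtain ⟨C₁, β₁, ℓ₁, p, hℓ₁, hC₁, hFBLc⟩ := hFBL
  obtain ⟨Γ, β₂, ℓ₂, c₂, C₂, K, n₀, hℓ₂, hc₂, hK1, hKlim, hn₀, -, -, hΓlim, hFC2c⟩ := hFC2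
  -- the constants
  obtain ⟨ℓ, hℓ⟩ : ∃ ℓ : ℝ, ℓ = min ℓ₁ ℓ₂ := ⟨_, rfl⟩
  have hℓ0 : 0 < ℓ := by rw [hℓ]; exact lt_min hℓ₁ hℓ₂
  have hℓℓ₁ : ℓ ≤ ℓ₁ := hℓ ▸ min_le_left _ _
  have hℓℓ₂ : ℓ ≤ ℓ₂ := hℓ ▸ min_le_right _ _
  obtain ⟨D, hD⟩ : ∃ D : ℝ, D = ℓ / 100 := ⟨_, rfl⟩
  have hD0 : 0 < D := by rw [hD]; positivity
  obtain ⟨M, hM⟩ : ∃ M : ℝ, M = 8 * C₁ ^ 2 / (c₂ * D ^ 8) + 1 := ⟨_, rfl⟩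
  have hM0 : 0 < M := by rw [hM]; positivity
  have hMC : 4 * C₁ ^ 2 / D ^ 8 ≤ c₂ * M / 2 := by
    have : c₂ * M / 2 = 4 * C₁ ^ 2 / D ^ 8 + c₂ / 2 := by
      rw [hM]; field_simp; ring
    rw [this]; linarith
  obtain ⟨δ₁, hδ₁, hKδ⟩ := exists_delta_of_tendsto_mul hKlim (ε := ℓ / 100) (by positivity)
  obtain ⟨δ₂, hδ₂, hΓδ⟩ := exists_delta_of_tendsto_div_atTop hΓlim M
  obtain ⟨s, hs⟩ : ∃ s : ℝ, s = min (min δ₁ (δ₂ / 2)) (ℓ / 100) := ⟨_, rfl⟩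
  have hs0 : 0 < s := by rw [hs]; positivity
  have hsδ₁ : s ≤ δ₁ := by rw [hs]; exact (min_le_left _ _).trans (min_le_left _ _)
  have hsδ₂ : 3 * s / 2 < δ₂ := by
    have : s ≤ δ₂ / 2 := by rw [hs]; exact (min_le_left _ _).trans (min_le_right _ _)
    linarith
  have hsℓ : s ≤ ℓ / 100 := by rw [hs]; exact min_le_right _ _
  have hsK : s * K (s / 2) < 2 * ℓ / 100 := by
    have := hKδ (s / 2) (by positivity) (by linarith)
    linarith
  -- the bump at height `s/2`, plateau radius `s/8`, support radius `s/4`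
  obtain ⟨v, hv0, -, hvone, hvsupp, hvts⟩ :=
    exists_bump_schwartz (EuclideanSpace.single 0 (s / 2)) (ρ := s / 8) (by positivity)
  -- small spacings
  have hn₀0 : (0 : ℝ) < n₀ := by exact_mod_cast hn₀
  obtain ⟨β₀, hβ₀⟩ := exists_of_tendsto_atTop_nhds_zero hlim
    (a₀ := min (ℓ / 100) (min (s / (2 * n₀)) (s / 16))) (by positivity)
  refine ⟨v, c₂ * M / 2 * (s / 16) ^ 8, max β₀ (max β₁ β₂), ℓ, ?_, ?_, by positivity, ?_⟩
  · -- compact support: the bump's `tsupport` is a closed ball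
    rw [HasCompactSupport, hvts]
    exact isCompact_closedBall _ _
  · -- positive time
    rw [hvts]
    intro y hy
    rw [mem_closedBall, dist_eq_norm] at hy
    have h1 := abs_apply_le_norm (y - EuclideanSpace.single 0 (s / 2)) 0
    have h2 : |y 0 - s / 2| ≤ 2 * (s / 8) := by simpa using h1.trans hy
    show 0 < y 0
    have := (abs_le.1 h2).1
    linarith
  intro β hβ L hL
  have hββ₀ : β₀ ≤ β := le_of_max_le_left hβ
  have hββ₁ : β₁ ≤ β := le_of_max_le_left (le_of_max_le_right hβ)
  have hββ₂ : β₂ ≤ β := le_of_max_le_right (le_of_max_le_right hβ)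
  have hα := hapos β
  have hαa₀ := hβ₀ β hββ₀
  have hαℓ : a β ≤ ℓ / 100 := (hαa₀.trans_le (min_le_left _ _)).le
  have hαn : a β ≤ s / (2 * n₀) := (hαa₀.trans_le ((min_le_right _ _).trans (min_le_left _ _))).le
  have hα16 : a β ≤ s / 16 := (hαa₀.trans_le ((min_le_right _ _).trans (min_le_right _ _))).le
  have hαn₀ : (n₀ : ℝ) * a β ≤ s / 2 := by
    rw [le_div_iff₀ (by positivity)] at hαn; linarith
  obtain ⟨hfem₁, hfem₂, hL'⟩ :=
    femto_budget (L := L) hℓℓ₁ hℓℓ₂ hsℓ hs0 hsK hαℓ hL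
  rw [← hD] at hfem₁ hfem₂ hL'
  -- the per-pair floor
  have key : ∀ x y : Fin 4 → ℤ, thetaTest 4 v (a β • siteToE x) ≠ 0 → v (a β • siteToE y) ≠ 0 →
      c₂ * M / 2 * a β ^ 8 ≤ torusE G r β L (fun U => dens G r x U * dens G r y U)
        - torusE G r β L (dens G r x) * torusE G r β L (dens G r y) := by
    intro x y hx hy
    refine pair_floor G r a hC₁ hFBLc hc₂ hK1 hFC2c hs0 hD0 hΓδ hsδ₂ hMC hββ₁ hββ₂ hα hαn₀
      hfem₁ hfem₂ hL' x y ?_ ?_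
    · rw [thetaTest_apply] at hx
      have := hvsupp _ hx
      rw [dist_eq_norm, norm_timeReflection_sub_single] at this
      linarith
    · have := hvsupp _ hy
      rw [dist_eq_norm] at this
      linarith
  -- Riemann mass of the two plateaux
  have hcover : ∀ j, |(EuclideanSpace.single (0 : Fin 4) (s / 2) : EuclideanSpace ℝ (Fin 4)) j|
      + s / 8 ≤ a β * L := fun j => by
    have : |(EuclideanSpace.single (0 : Fin 4) (s / 2) : EuclideanSpace ℝ (Fin 4)) j| ≤ s / 2 := by
      rw [PiLp.single_apply]
      split_ifs
      · rw [abs_of_pos (by positivity)]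
      · rw [abs_zero]; positivity
    nlinarith
  have hSy : (s / 8 / (2 * a β)) ^ 4 ≤ ∑ y ∈ box 4 L, v (a β • siteToE y) :=
    pow_le_sum_box hv0 hα (fun z hz => hvone z hz) (by linarith) hcover
  have hSx : (s / 8 / (2 * a β)) ^ 4 ≤ ∑ x ∈ box 4 L, thetaTest 4 v (a β • siteToE x) := by
    refine pow_le_sum_box (p := -EuclideanSpace.single 0 (s / 2)) (fun z => ?_) hα
      (fun z hz => ?_) (by linarith) (fun j => by simpa using hcover j)
    · rw [thetaTest_apply]; exact hv0 _
    · rw [thetaTest_apply]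
      refine hvone _ ?_
      rwa [dist_eq_norm, norm_timeReflection_sub_single, ← sub_neg_eq_add, ← dist_eq_norm]
  -- summation
  have hsum := mul_sum_mul_sum_le (B := box 4 L) (κ := c₂ * M / 2 * a β ^ 8)
    (f := fun x => thetaTest 4 v (a β • siteToE x)) (g := fun y => v (a β • siteToE y))
    (C := fun x y => torusE G r β L (fun U => dens G r x U * dens G r y U)
      - torusE G r β L (dens G r x) * torusE G r β L (dens G r y))
    (fun x => by rw [thetaTest_apply]; exact hv0 _) (fun y => hv0 _) key
  unfold Q2
  refine le_trans ?_ hsum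
  have hα0 : a β ≠ 0 := hα.ne'
  calc c₂ * M / 2 * (s / 16) ^ 8
      = c₂ * M / 2 * a β ^ 8 * ((s / 8 / (2 * a β)) ^ 4 * (s / 8 / (2 * a β)) ^ 4) := by
        field_simp; ring
    _ ≤ _ := mul_le_mul_of_nonneg_left (mul_le_mul hSx hSy (by positivity)
        ((by positivity : (0 : ℝ) ≤ (s / 8 / (2 * a β)) ^ 4).trans hSx)) (by positivity)

/-- **The three-point floor with compactly supported witnesses** (= landed `StubLower.lowerBounds_threePoint`, same
proof, recording that the three bumps have `tsupport = closedBall`). [folklore] -/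
theorem lowerBoundsC_threePoint (hapos : ∀ β, 0 < a β) (hlim : Tendsto a atTop (𝓝 0))
    (hFBL : FBL G r a) (hFC2 : FC2 G r a) (hFC3 : FC3 G r a) :
    ∃ (f g h : 𝓢(EuclideanSpace ℝ (Fin 4), ℝ)) (ε β₅ Λ₅ : ℝ),
      HasCompactSupport (f : EuclideanSpace ℝ (Fin 4) → ℝ) ∧ HasCompactSupport (g : EuclideanSpace ℝ (Fin 4) → ℝ) ∧
      HasCompactSupport (h : EuclideanSpace ℝ (Fin 4) → ℝ) ∧
      Disjoint (tsupport f) (tsupport g) ∧ Disjoint (tsupport g) (tsupport h) ∧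
      Disjoint (tsupport f) (tsupport h) ∧ 0 < ε ∧
      ∀ β : ℝ, β₅ ≤ β → ∀ L : ℕ, Λ₅ ≤ a β * L → ε ≤ |Q3 G r β L (a β) f g h| := by
  obtain ⟨C₁, β₁, ℓ₁, p, hℓ₁, hC₁, hFBLc⟩ := hFBL
  obtain ⟨Γ, β₂, ℓ₂, c₂, C₂, K, n₀, hℓ₂, hc₂, hK1, hKlim, hn₀, -, hΓ1, -, hFC2c⟩ := hFC2
  obtain ⟨v, w, σ, δ, Γ₃, β₃, ℓ₃, c₃, K₃, n₃, hσ, hδ, h2v, h2w, h2vw, hℓ₃, hc₃, hK₃1, hK₃lim, -, -,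
    -, hΓ₃lim, hFC3c⟩ := hFC3
  -- the constants
  obtain ⟨ℓ, hℓ⟩ : ∃ ℓ : ℝ, ℓ = min (min ℓ₁ ℓ₂) ℓ₃ := ⟨_, rfl⟩
  have hℓ0 : 0 < ℓ := by rw [hℓ]; exact lt_min (lt_min hℓ₁ hℓ₂) hℓ₃
  have hℓℓ₁ : ℓ ≤ ℓ₁ := hℓ ▸ (min_le_left _ _).trans (min_le_left _ _)
  have hℓℓ₂ : ℓ ≤ ℓ₂ := hℓ ▸ (min_le_left _ _).trans (min_le_right _ _)
  have hℓℓ₃ : ℓ ≤ ℓ₃ := hℓ ▸ min_le_right _ _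
  obtain ⟨Vmin, Vmax, hVmin, hVmax, hVV, hVv, hVw, hVvw, hVv', hVw', hVvw', hδV⟩ :=
    shape_constants hδ h2v h2w h2vw
  obtain ⟨D, hD⟩ : ∃ D : ℝ, D = ℓ / 100 := ⟨_, rfl⟩
  have hD0 : 0 < D := by rw [hD]; positivity
  obtain ⟨smax, hsmax⟩ : ∃ smax : ℝ, smax = ℓ / (100 * (Vmax + 1)) := ⟨_, rfl⟩
  have hsmax0 : 0 < smax := by rw [hsmax]; positivity
  have hC₂p : 0 ≤ max C₂ 0 := le_max_right _ _
  obtain ⟨M₃, hM₃⟩ : ∃ M₃ : ℝ, M₃ = 12 * C₁ * max C₂ 0 / (c₃ * D ^ 4 * Vmin ^ 8)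
    + 16 * C₁ ^ 3 * smax ^ 8 / (c₃ * D ^ 12) + 1 := ⟨_, rfl⟩
  have hM₃0 : 0 < M₃ := by rw [hM₃]; positivity
  obtain ⟨δ₁, hδ₁, hKδ⟩ := exists_delta_of_tendsto_mul hKlim (ε := ℓ * Vmin / (10 * Vmax)) (by positivity)
  obtain ⟨δ₂, hδ₂, hK₃δ⟩ := exists_delta_of_tendsto_mul hK₃lim (ε := ℓ / 20) (by positivity)
  obtain ⟨δ₃, hδ₃, hΓ₃δ⟩ := exists_delta_of_tendsto_div_atTop hΓ₃lim M₃
  obtain ⟨s, hs⟩ : ∃ s : ℝ, s = min (min (δ₁ / (2 * (Vmin + 1))) δ₂) (min (δ₃ / 2) smax) := ⟨_, rfl⟩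
  have hs0 : 0 < s := by rw [hs]; positivity
  have hs₁ : s ≤ δ₁ / (2 * (Vmin + 1)) := hs ▸ (min_le_left _ _).trans (min_le_left _ _)
  have hs₂ : s ≤ δ₂ := hs ▸ (min_le_left _ _).trans (min_le_right _ _)
  have hs₃ : s ≤ δ₃ / 2 := hs ▸ (min_le_right _ _).trans (min_le_left _ _)
  have hs₄ : s ≤ smax := hs ▸ (min_le_right _ _).trans (min_le_right _ _)
  have hsδ₃ : s < δ₃ := by linarith only [hs₃, hδ₃]
  have hsV : s * Vmax ≤ ℓ / 100 := by
    have h1 : s * Vmax ≤ smax * Vmax := mul_le_mul_of_nonneg_right hs₄ hVmax.le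
    have h2 : smax * Vmax ≤ ℓ / 100 := by
      rw [hsmax, div_mul_eq_mul_div, div_le_div_iff₀ (by positivity) (by positivity)]
      have : 0 ≤ ℓ * 100 := by positivity
      linarith only [this]
    linarith only [h1, h2]
  have hsℓ : s ≤ ℓ / 100 := by
    have : smax ≤ ℓ / 100 :=
      hsmax ▸ div_le_div_of_nonneg_left hℓ0.le (by positivity) (by linarith only [hVmax])
    linarith only [this, hs₄]
  -- growth clauses at the scale `s`
  have hsVmin : s * Vmin < δ₁ := by
    have h1 : s * Vmin ≤ δ₁ / (2 * (Vmin + 1)) * Vmin := mul_le_mul_of_nonneg_right hs₁ hVmin.le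
    have h2 : δ₁ / (2 * (Vmin + 1)) * Vmin < δ₁ := by
      rw [div_mul_eq_mul_div, div_lt_iff₀ (by positivity)]
      exact mul_lt_mul_of_pos_left (by linarith only [hVmin]) hδ₁
    linarith only [h1, h2]
  have hs0' : s ≠ 0 := hs0.ne'
  have hVmin0 : Vmin ≠ 0 := hVmin.ne'
  have hVmax0 : Vmax ≠ 0 := hVmax.ne'
  have hKt : s * Vmax * K (s * Vmin) < ℓ / 10 := by
    have h1 := hKδ (s * Vmin) (by positivity) hsVmin
    have e : s * Vmax * K (s * Vmin) = s * Vmin * K (s * Vmin) * (Vmax / Vmin) := by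
      field_simp
    rw [e]
    calc s * Vmin * K (s * Vmin) * (Vmax / Vmin) < ℓ * Vmin / (10 * Vmax) * (Vmax / Vmin) :=
          mul_lt_mul_of_pos_right h1 (by positivity)
      _ = ℓ / 10 := by field_simp
  have hK₃t : s * K₃ (s / 2) < ℓ / 10 := by
    have := hK₃δ (s / 2) (by positivity) (by linarith only [hs₂, hs0])
    linarith only [this]
  have hM₃C := M3_bound (C₂p := max C₂ 0) hC₁ hc₃ hD0 hVmin hs0 hs₄
  rw [← hM₃] at hM₃C
  -- the three bumps: plateau radius `δ s / 8`, support radius `δ s / 4`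
  have hρ : 0 < δ * s / 8 := by positivity
  obtain ⟨f, hf0, -, hfone, hfsupp, hfts⟩ :=
    exists_bump_schwartz (0 : EuclideanSpace ℝ (Fin 4)) (ρ := δ * s / 8) hρ
  obtain ⟨g, hg0, -, hgone, hgsupp, hgts⟩ := exists_bump_schwartz (s • v) (ρ := δ * s / 8) hρ
  obtain ⟨h, hh0, -, hhone, hhsupp, hhts⟩ := exists_bump_schwartz (s • w) (ρ := δ * s / 8) hρ
  -- small spacings
  have hn₀0 : (0 : ℝ) < n₀ := by exact_mod_cast hn₀
  obtain ⟨β₀, hβ₀⟩ := exists_of_tendsto_atTop_nhds_zero hlim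
    (a₀ := min (min (min (ℓ / 100) (δ * s / 16)) (min (s / 2) (s / ((n₃ : ℝ) + 1))))
      (min (min (δ * s / (2 * (‖v‖ + δ))) (δ * s / (2 * (‖w‖ + δ)))) (s * Vmin / n₀)))
    (by positivity)
  refine ⟨f, g, h, c₃ * M₃ / (2 * s ^ 8) * (δ * s / 16) ^ 12, max (max β₀ β₁) (max β₂ β₃), ℓ,
    ?_, ?_, ?_, ?_, ?_, ?_, by positivity, ?_⟩
  · rw [HasCompactSupport, hfts]; exact isCompact_closedBall _ _
  · rw [HasCompactSupport, hgts]; exact isCompact_closedBall _ _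
  · rw [HasCompactSupport, hhts]; exact isCompact_closedBall _ _
  · rw [hfts, hgts]
    refine closedBall_disjoint_closedBall ?_
    rw [dist_eq_norm, zero_sub, norm_neg, norm_smul, Real.norm_eq_abs, abs_of_pos hs0]
    have := mul_lt_mul_of_pos_left (show δ / 2 < ‖v‖ by linarith only [h2v, hδ]) hs0
    linarith only [this]
  · rw [hgts, hhts]
    refine closedBall_disjoint_closedBall ?_
    rw [dist_eq_norm, ← smul_sub, norm_smul, Real.norm_eq_abs, abs_of_pos hs0]
    have := mul_lt_mul_of_pos_left (show δ / 2 < ‖v - w‖ by linarith only [h2vw, hδ]) hs0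
    linarith only [this]
  · rw [hfts, hhts]
    refine closedBall_disjoint_closedBall ?_
    rw [dist_eq_norm, zero_sub, norm_neg, norm_smul, Real.norm_eq_abs, abs_of_pos hs0]
    have := mul_lt_mul_of_pos_left (show δ / 2 < ‖w‖ by linarith only [h2w, hδ]) hs0
    linarith only [this]
  intro β hβ L hL
  have hββ₀ : β₀ ≤ β := le_of_max_le_left (le_of_max_le_left hβ)
  have hββ₁ : β₁ ≤ β := le_of_max_le_right (le_of_max_le_left hβ)
  have hββ₂ : β₂ ≤ β := le_of_max_le_left (le_of_max_le_right hβ)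
  have hββ₃ : β₃ ≤ β := le_of_max_le_right (le_of_max_le_right hβ)
  have hα := hapos β
  have hαa₀ := (hβ₀ β hββ₀).le
  have hαℓ : a β ≤ ℓ / 100 :=
    hαa₀.trans ((min_le_left _ _).trans ((min_le_left _ _).trans (min_le_left _ _)))
  have hα16 : a β ≤ δ * s / 16 :=
    hαa₀.trans ((min_le_left _ _).trans ((min_le_left _ _).trans (min_le_right _ _)))
  have hα2 : a β ≤ s / 2 :=
    hαa₀.trans ((min_le_left _ _).trans ((min_le_right _ _).trans (min_le_left _ _)))
  have hαn₃' : a β ≤ s / ((n₃ : ℝ) + 1) :=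
    hαa₀.trans ((min_le_left _ _).trans ((min_le_right _ _).trans (min_le_right _ _)))
  have hαv' : a β ≤ δ * s / (2 * (‖v‖ + δ)) :=
    hαa₀.trans ((min_le_right _ _).trans ((min_le_left _ _).trans (min_le_left _ _)))
  have hαw' : a β ≤ δ * s / (2 * (‖w‖ + δ)) :=
    hαa₀.trans ((min_le_right _ _).trans ((min_le_left _ _).trans (min_le_right _ _)))
  have hαn₀' : a β ≤ s * Vmin / n₀ := hαa₀.trans ((min_le_right _ _).trans (min_le_right _ _))
  have hαn₃ : ((n₃ : ℝ) + 1) * a β ≤ s := by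
    rw [le_div_iff₀ (by positivity)] at hαn₃'; linarith only [hαn₃']
  have hαv : a β * (‖v‖ + δ) ≤ δ * s / 2 := by
    rw [le_div_iff₀ (by positivity)] at hαv'; linarith only [hαv']
  have hαw : a β * (‖w‖ + δ) ≤ δ * s / 2 := by
    rw [le_div_iff₀ (by positivity)] at hαw'; linarith only [hαw']
  have hαn₀ : (n₀ : ℝ) * a β ≤ s * Vmin := by
    rw [le_div_iff₀ hn₀0] at hαn₀'; linarith only [hαn₀']
  obtain ⟨hfem₁, hfem₂, hfem₃, hL', hsℓ₂⟩ := femto_budget3 (k := K (s * Vmin)) (k₃ := K₃ (s / 2))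
    (L := L) hℓ0.le hℓℓ₁ hℓℓ₂ hℓℓ₃ hKt hK₃t hsV hαℓ hL
  rw [← hD] at hfem₁ hfem₂ hfem₃ hL'
  -- the per-triple floor
  have key : ∀ x y z : Fin 4 → ℤ, f (a β • siteToE x) ≠ 0 → g (a β • siteToE y) ≠ 0 →
      h (a β • siteToE z) ≠ 0 → c₃ * M₃ / (2 * s ^ 8) * a β ^ 12 ≤ σ * torusK3 G r β L x y z := by
    intro x y z hx hy hz
    refine triple_floor G r a hC₁ hFBLc hc₂ hK1 hΓ1 hFC2c hσ hδ hc₃ hK₃1 hFC3c hs0 hD0 hM₃0.le hVmin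
      hVv hVw hVvw hVv' hVw' hVvw' hΓ₃δ hsδ₃ hsℓ₂ hM₃C hββ₁ hββ₂ hββ₃ hα hαn₀ hαn₃ hα2 hαv hαw
      hfem₁ hfem₂ hfem₃ hL' x y z ?_ ?_ ?_
    · have := hfsupp _ hx
      rw [dist_eq_norm, sub_zero] at this
      linarith only [this]
    · have := hgsupp _ hy
      rw [dist_eq_norm] at this
      linarith only [this]
    · have := hhsupp _ hz
      rw [dist_eq_norm] at this
      linarith only [this]
  -- Riemann mass of the three plateaux
  have hcov2 : 2 * (s * Vmax) ≤ a β * L := by linarith only [hsV, hL, hℓ0]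
  have hnv : ‖s • v‖ ≤ s * Vmax := by
    rw [norm_smul, Real.norm_eq_abs, abs_of_pos hs0]
    exact mul_le_mul_of_nonneg_left (by linarith only [hVv', hδ]) hs0.le
  have hnw : ‖s • w‖ ≤ s * Vmax := by
    rw [norm_smul, Real.norm_eq_abs, abs_of_pos hs0]
    exact mul_le_mul_of_nonneg_left (by linarith only [hVw', hδ]) hs0.le
  have hn0 : ‖(0 : EuclideanSpace ℝ (Fin 4))‖ ≤ s * Vmax := by rw [norm_zero]; positivity
  have h2α : 2 * a β ≤ δ * s / 8 := by linarith only [hα16]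
  have hSf : (δ * s / 8 / (2 * a β)) ^ 4 ≤ ∑ x ∈ box 4 L, f (a β • siteToE x) :=
    pow_le_sum_box hf0 hα (fun z hz => hfone z hz) h2α (centre_cover hs0.le hn0 hδV hcov2)
  have hSg : (δ * s / 8 / (2 * a β)) ^ 4 ≤ ∑ y ∈ box 4 L, g (a β • siteToE y) :=
    pow_le_sum_box hg0 hα (fun z hz => hgone z hz) h2α (centre_cover hs0.le hnv hδV hcov2)
  have hSh : (δ * s / 8 / (2 * a β)) ^ 4 ≤ ∑ z ∈ box 4 L, h (a β • siteToE z) :=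
    pow_le_sum_box hh0 hα (fun z hz => hhone z hz) h2α (centre_cover hs0.le hnw hδV hcov2)
  -- summation: `σ Q3 ≥ ε`
  have hsum := mul_sum_mul_sum_mul_sum_le (B := box 4 L) (κ := c₃ * M₃ / (2 * s ^ 8) * a β ^ 12)
    (f := fun x => f (a β • siteToE x)) (g := fun y => g (a β • siteToE y))
    (h := fun z => h (a β • siteToE z)) (C := fun x y z => σ * torusK3 G r β L x y z)
    (fun x => hf0 _) (fun y => hg0 _) (fun z => hh0 _) key
  have hσQ : σ * Q3 G r β L (a β) f g h =
      ∑ x ∈ box 4 L, ∑ y ∈ box 4 L, ∑ z ∈ box 4 L,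
        f (a β • siteToE x) * g (a β • siteToE y) * h (a β • siteToE z) *
          (σ * torusK3 G r β L x y z) := by
    unfold Q3
    rw [Finset.mul_sum]
    refine Finset.sum_congr rfl fun x _ => ?_
    rw [Finset.mul_sum]
    refine Finset.sum_congr rfl fun y _ => ?_
    rw [Finset.mul_sum]
    refine Finset.sum_congr rfl fun z _ => ?_
    ring
  have hσabs : σ * Q3 G r β L (a β) f g h ≤ |Q3 G r β L (a β) f g h| := by
    rcases hσ with rfl | rfl
    · rw [one_mul]; exact le_abs_self _
    · rw [neg_one_mul]; exact neg_le_abs _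
  refine le_trans ?_ hσabs
  rw [hσQ]
  refine le_trans ?_ hsum
  have hα0 : a β ≠ 0 := hα.ne'
  have hpos : (0 : ℝ) ≤ (δ * s / 8 / (2 * a β)) ^ 4 := by positivity
  calc c₃ * M₃ / (2 * s ^ 8) * (δ * s / 16) ^ 12
      = c₃ * M₃ / (2 * s ^ 8) * a β ^ 12 *
          ((δ * s / 8 / (2 * a β)) ^ 4 * (δ * s / 8 / (2 * a β)) ^ 4 * (δ * s / 8 / (2 * a β)) ^ 4) := by
        field_simp; ring
    _ ≤ _ := mul_le_mul_of_nonneg_left (mul_le_mul (mul_le_mul hSf hSg hpos (hpos.trans hSf)) hSh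
        hpos (mul_nonneg (hpos.trans hSf) (hpos.trans hSg))) (by positivity)


end Floors

end Summit.QuantumFields.YangMills.Cruxes.UVSeamRec.FloorsC

end
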